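import Literature.AlgebraicGeometry.AbelianSchemes.AbelianSchemeOverRingAction
import HarnessLib

/-!
# Level transport along an isogeny ROOF and a COVER: `q̄(σᵃx̄) = c̄(σᵃx̄″)`, `c̄′(σᵃx̄′) = F(σᵃx̄)`, `q̄ ≫ θ = F`, `c̄′ = f ≫ c̄ ≫ θ`,
# `Ker(c̄ ≫ θ) ⊆ A″[𝔞]`, `𝔞 + (N) = 𝒪` ⟹ `f(σᵃx̄′) = σᵃx̄″` for `N`-torsion points

Topic `Literature/AlgebraicGeometry/AbelianSchemes`, namespace `Literature.AlgebraicGeometry.AbelianSchemes.AbelianSchemeOver`.  THEOREMS ONLY (no definition, no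
named fact, no `instance`, no notation, no `sorry`); ANY base `S`, any test object `T` (e.g. `Spec κ̄`).  Cell `hodgecm-mathlib` (D-0151), FLOOR 0, P6 «MOD programme»
(crux hLiu418 = stmt-HodgeConjecture-24832, `--supports`, count-neutral), σ2 (β′) lineage of `stub_HFROB`, **BRICK V «LEVEL LEG»** of the HFROB ← `frob₀` derivation
(card J10 step (4), level clause): the roof law (r5₀) `q̄(σᵃ(x̄)) = c̄(σᵃ(x̄″))`, the cover law (f5) `c̄′(σᵃ(x̄′)) = F_q(σᵃ(x̄))`, the σ2 identifications `q̄ ≫ θ = F_q`,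
`c̄′ = f ≫ c̄ ≫ θ` (★ `FrobeniusTwistOfRoof`, ★ `SerreTensorRecognitionOfPoints` §3, ★ `SerreTensorUntwist`) give `(c̄ ≫ θ)(f(σᵃx̄′)) = (c̄ ≫ θ)(σᵃx̄″)`; the kernel of
`c̄ ≫ θ = ψ″_𝔞 ≫ e′⁻¹` consists of `𝔞`-torsion, level points are `N`-torsion, and **`𝔞 + (N) = 𝒪`** (the datum's `twistIdeal_coprime`, Defs ED. 2 item (f6)) kills
`A″[𝔞] ∩ A″[N]`; hence **`f(σᵃx̄′) = σᵃx̄″`** — the level clause of `tupleIsoAt`.  Group algebra on `T`-points of group objects (Mathlib `GrpObj.div_comp`,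
`MonObj.comp_mul`, ★ `RingAction.i_add ∕ i_mul ∕ i_one`).  HC_CM is proved only modulo the 2 remaining named inputs (hLiu418, h413) until rung 0 closes; this file
discharges none of them.

## Contents
* §1 **`eq_of_comp_eq_of_pow_eq_one_of_coprime`** — `u : X → Y` a homomorphism whose kernel (on `T`-points) is `𝔞`-torsion for an `𝒪`-action `ι` on `X`, `𝔞 ⊔ (N) = ⊤`:
  two `N`-torsion `T`-points with the same image under `u` are EQUAL (`X` commutative, e.g. ★ `isCommMonObj_of_field`); `pow_eq_one_of_forall_comp_i_eq_one_of_coprime` (an `𝔞`-torsion `N`-torsion point is trivial).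
* §2 **`comp_eq_of_roof_of_cover`** — the chase: `(P′ ≫ f) ≫ (c̄ ≫ θ) = P″ ≫ (c̄ ≫ θ)` from (r5₀)(f5) + `q̄ ≫ θ = F` + `c̄′ = f ≫ c̄ ≫ θ`;
  **`level_transport_of_roof_of_cover`** — the head: `P′ ≫ f = P″`.

## References
* [MumfordFogartyKirwan1994] D. Mumford, J. Fogarty, F. Kirwan, *GIT* (3rd ed. 1994), Ch. 7 §2 Def. 7.1–7.2 (p. 129) (level structures, exact transport).
* [MumfordAV1970] D. Mumford, *Abelian Varieties* (1970), §7 Thm. 4 (p. 72).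
* [Shimura1998] G. Shimura, §18.6 (proof of Thm. 18.6, p. 127: «`(t^σ)~ = π(t̃)`»).
-/

noncomputable section

universe u

open CategoryTheory CategoryTheory.Limits AlgebraicGeometry MonoidalCategory CartesianMonoidalCategory
open scoped MonObj

namespace Literature.AlgebraicGeometry.AbelianSchemes

namespace AbelianSchemeOver

variable {S : Scheme.{u}} {X : AbelianSchemeOver S} {O : Type*} [CommRing O] (act : X.RingAction O)

/-! ## §1 `𝔞`-torsion meets `N`-torsion trivially when `𝔞 + (N) = 𝒪` -/

/-- **An `𝔞`-torsion `N`-torsion point is trivial when `𝔞 + (N) = 𝒪`**: write `1 = a + r·N` (`a ∈ 𝔞`); then `d = ι(1)d = ι(a)d · ι(r)(ι(N)d) = 1`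
(`ι(N) = [N]`, ★ `RingAction.i_add ∕ i_mul ∕ i_natCast`-style algebra). [cite: MumfordAV1970, §7 Thm. 4 (p. 72)] -/
theorem pow_eq_one_of_forall_comp_i_eq_one_of_coprime {𝔞 : Ideal O} {N : ℕ} (hcop : 𝔞 ⊔ Ideal.span {(N : O)} = ⊤)
    {T : Over S} (d : T ⟶ X.X) (h𝔞 : ∀ a ∈ 𝔞, d ≫ act.i a = 1) (hN : d ^ N = 1) : d = 1 := by
  obtain ⟨a, ha, b, hb, hab⟩ := Submodule.mem_sup.1 ((Ideal.eq_top_iff_one _).1 hcop)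
  obtain ⟨r, rfl⟩ := Ideal.mem_span_singleton'.1 hb
  have h1 : d ≫ act.i 1 = d := by rw [act.i_one, Category.comp_id]
  haveI := act.isMonHom r
  have hNat : act.i (N : O) = (𝟙 X.X) ^ N := by rw [← Nat.smul_one_eq_cast, act.i_nsmul, act.i_one]
  rw [← h1, ← hab, act.i_add, MonObj.comp_mul, h𝔞 a ha, one_mul, act.i_mul, ← Category.assoc, hNat, MonObj.comp_pow, Category.comp_id, hN,
    MonObj.one_comp]

/-- **TWO `N`-TORSION POINTS WITH THE SAME IMAGE UNDER A HOMOMORPHISM WHOSE KERNEL IS `𝔞`-TORSION ARE EQUAL** (`𝔞 + (N) = 𝒪`).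
[cite: MumfordFogartyKirwan1994, Ch. 7 §2 Definition 7.1 (p. 129)] [cite: MumfordAV1970, §7 Thm. 4 (p. 72)] -/
theorem eq_of_comp_eq_of_pow_eq_one_of_coprime [IsCommMonObj X.X] {Y : Over S} [GrpObj Y] (u : X.X ⟶ Y) [IsMonHom u] {𝔞 : Ideal O} {N : ℕ}
    (hcop : 𝔞 ⊔ Ideal.span {(N : O)} = ⊤) {T : Over S}
    (hker : ∀ d : T ⟶ X.X, d ≫ u = 1 → ∀ a ∈ 𝔞, d ≫ act.i a = 1)
    (P₁ P₂ : T ⟶ X.X) (h₁ : P₁ ^ N = 1) (h₂ : P₂ ^ N = 1) (h : P₁ ≫ u = P₂ ≫ u) : P₁ = P₂ := by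
  have hd : (P₁ * P₂⁻¹) ≫ u = 1 := by rw [MonObj.mul_comp, GrpObj.inv_comp, h, mul_inv_cancel]
  have hdN : (P₁ * P₂⁻¹) ^ N = 1 := by rw [mul_pow, inv_pow, h₁, h₂, inv_one, mul_one]
  have := pow_eq_one_of_forall_comp_i_eq_one_of_coprime act hcop (P₁ * P₂⁻¹) (hker _ hd) hdN
  exact mul_inv_eq_one.1 this

/-! ## §2 The level leg -/

section Chase

variable {A A' A'' B Aq : AbelianSchemeOver S}
  (qb : A.X ⟶ B.X) (cb : A''.X ⟶ B.X) (c' : A'.X ⟶ Aq.X) (F : A.X ⟶ Aq.X) (θ : B.X ⟶ Aq.X) (f : A'.X ⟶ A''.X)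

/-- **THE CHASE**: `(P′ ≫ f) ≫ (c̄ ≫ θ) = P″ ≫ (c̄ ≫ θ)` from the roof law `P ≫ q̄ = P″ ≫ c̄` ((r5₀)), the cover law `P′ ≫ c̄′ = P ≫ F` ((f5)), `q̄ ≫ θ = F` and
`c̄′ = f ≫ c̄ ≫ θ`. [cite: Shimura1998, §18.6 proof of Thm. 18.6, p. 127] -/
theorem comp_eq_of_roof_of_cover (hθ : qb ≫ θ = F) (hc' : c' = f ≫ cb ≫ θ) {T : Over S} (P : T ⟶ A.X) (P' : T ⟶ A'.X) (P'' : T ⟶ A''.X)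
    (hr5 : P ≫ qb = P'' ≫ cb) (hf5 : P' ≫ c' = P ≫ F) : (P' ≫ f) ≫ (cb ≫ θ) = P'' ≫ (cb ≫ θ) := by
  rw [Category.assoc, ← hc', hf5, ← hθ, ← Category.assoc, hr5, Category.assoc]

variable (act'' : A''.RingAction O)

/-- **THE LEVEL LEG OF HFROB: `f(σᵃx̄′) = σᵃx̄″`.**  Hypotheses: the chase data of `comp_eq_of_roof_of_cover`, the kernel of `c̄ ≫ θ` (on `T`-points) is `𝔞`-torsion for the action
`ι″` on `A″` (for the σ2 pen: `c̄ ≫ θ = ψ″_𝔞 ≫ e′⁻¹`, ★ `comp_serreTranslate_eq_one_iff_forall_mem`), the points `P′ ≫ f`, `P″` are `N`-torsion (level-`N` points; `f` a homomorphism),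
and `𝔞 + (N) = 𝒪` (the datum's `twistIdeal_coprime`). [cite: MumfordFogartyKirwan1994, Ch. 7 §2 Definition 7.1 and 7.2 (p. 129)] [cite: Shimura1998, §18.6 proof of Thm. 18.6, p. 127] -/
theorem level_transport_of_roof_of_cover [IsCommMonObj A''.X] [IsMonHom cb] [IsMonHom θ] [IsMonHom f] (hθ : qb ≫ θ = F)
    (hc' : c' = f ≫ cb ≫ θ)
    {𝔞 : Ideal O} {N : ℕ} (hcop : 𝔞 ⊔ Ideal.span {(N : O)} = ⊤) {T : Over S}
    (hker : ∀ d : T ⟶ A''.X, d ≫ (cb ≫ θ) = 1 → ∀ a ∈ 𝔞, d ≫ act''.i a = 1)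
    (P : T ⟶ A.X) (P' : T ⟶ A'.X) (P'' : T ⟶ A''.X) (hP' : P' ^ N = 1) (hP'' : P'' ^ N = 1)
    (hr5 : P ≫ qb = P'' ≫ cb) (hf5 : P' ≫ c' = P ≫ F) : P' ≫ f = P'' :=
  eq_of_comp_eq_of_pow_eq_one_of_coprime act'' (cb ≫ θ) hcop hker (P' ≫ f) P''
    (by rw [← MonObj.pow_comp, hP', MonObj.one_comp]) hP'' (comp_eq_of_roof_of_cover qb cb c' F θ f hθ hc' P P' P'' hr5 hf5)

end Chase

end AbelianSchemeOver

end Literature.AlgebraicGeometry.AbelianSchemes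

end
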